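import Summits.CriticalPhenomena.PercolationContinuityZ3.Theorems.Transplant.FKConnectivityAllQAntipodalWiredDefs
import Summits.CriticalPhenomena.PercolationContinuityZ3.Theorems.Transplant.FKConnectivityAllQAntipodalX2SpineStep
import HarnessLib

/-!
# Connectivity correlation inequalities for `φ_{w,q}` — gluing laws for a GENERAL pair of configurations on one side (the pointwise
# identities behind Theorem U with a wired marked edge)

Helper file (`--supports stmt-CriticalPhenomena-4575`), FK sub-lane `prim-bschramm-fk-2` (gen 14); builds on p205010 (kernel theorem,
internal audit signed; external expert review pending).  No definitions, no named facts, no sorries; standard axioms.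

Gen 11's pointwise composition identities `FK.ap_summand_parallel/series` are stated for a configuration `γ₁` of the first part and its
COMPLEMENT.  Here they are re-proved for an ARBITRARY pair `(ω₁, ω₁')` of configurations of the first part (`FK.ap_summand_parallel_gen`,
`FK.ap_summand_series_gen`, `FK.ap_summand_series_gen'`): the proofs only use the gluing lemmas `FK.clusterCount_parallel/series` and
`FK.reachable_*_iff`, which hold for arbitrary configurations.  The sibling `…AntipodalWiredUpc.lean` applies them to the pairs
`(C ∪ z, (T∖C) ∪ z)` of the wired functional `FK.apUpcW`.
[cite: Grimmett2006, §1.4 eq. (1.20) (p. 15); §3.8 Thm. (3.90) (pp. 61–62)]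
-/

noncomputable section

namespace Summit.CriticalPhenomena.PercolationContinuityZ3.Theorems

namespace FK

open SimpleGraph Literature.Probability.LatticeModels Literature.Probability.Percolation X2Word
open scoped Classical

variable {V : Type*} [Fintype V]

/-! ### Pointwise composition identities for a general pair on the first side -/

section Pointwise

variable {E₁ E₂ : Finset (Sym2 V)} {V₁ V₂ : Set V}

set_option linter.unusedSimpArgs false in
/-- **Parallel gluing, general pair on the first side**: for `ω₁, ω₁' ⊆ E₁` and a complementary pair `(γ₂, M₂∖γ₂)` of the second part,
`q^{2|V|} q^{k(ω₁∪γ₂)+k(ω₁'∪γ₂ᶜ)}((c ∨ c₂) - (c' ∨ c̄₂)) = q^{a₂} α(γ₂)·q^{k(ω₁)+k(ω₁')}(c - c') + q^{k(ω₁)+k(ω₁')} β(ω₁,ω₁')·q^{a₂}(c₂ - c̄₂)`.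
[cite: Grimmett2006, §3.8 (pp. 61–62)] -/
theorem ap_summand_parallel_gen (q : ℝ) {s t : V} (h₁ : ∀ e ∈ (↑E₁ : Set (Sym2 V)), ∀ z ∈ e, z ∈ V₁)
    (h₂ : ∀ e ∈ (↑E₂ : Set (Sym2 V)), ∀ z ∈ e, z ∈ V₂) (hS : V₁ ∩ V₂ ⊆ {s, t}) (hst : s ≠ t)
    {ω₁ ω₁' M₂ γ₂ : Finset (Sym2 V)} (hω₁ : ω₁ ⊆ E₁) (hω₁' : ω₁' ⊆ E₁) (hM₂ : M₂ ⊆ E₂) (hγ₂ : γ₂ ⊆ M₂) (x : ℝ) :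
    q ^ (2 * Fintype.card V) *
        (q ^ (clusterCount (↑(ω₁ ∪ γ₂) : BondConfig V) ∅ + clusterCount (↑(ω₁' ∪ (M₂ \ γ₂)) : BondConfig V) ∅) *
          ((apConn (ω₁ ∪ γ₂) s t - apConn (ω₁' ∪ (M₂ \ γ₂)) s t) * x)) =
      q ^ apExp M₂ γ₂ *
          (((1 - apConn γ₂ s t) * (1 - apConn (M₂ \ γ₂) s t) + q * ((1 - apConn γ₂ s t) * apConn (M₂ \ γ₂) s t)) *
            (q ^ (clusterCount (↑ω₁ : BondConfig V) ∅ + clusterCount (↑ω₁' : BondConfig V) ∅) *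
              ((apConn ω₁ s t - apConn ω₁' s t) * x))) +
        q ^ (clusterCount (↑ω₁ : BondConfig V) ∅ + clusterCount (↑ω₁' : BondConfig V) ∅) *
          (((1 - apConn ω₁ s t) * (1 - apConn ω₁' s t) + q * (apConn ω₁ s t * (1 - apConn ω₁' s t))) *
            (q ^ apExp M₂ γ₂ * ((apConn γ₂ s t - apConn (M₂ \ γ₂) s t) * x))) := by
  have k1 := clusterCount_parallel (ω₁ := (↑ω₁ : Set (Sym2 V))) (ω₂ := (↑γ₂ : Set (Sym2 V))) h₁ h₂ hS
    (Finset.coe_subset.2 hω₁) (Finset.coe_subset.2 (hγ₂.trans hM₂)) hst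
  have k2 := clusterCount_parallel (ω₁ := (↑ω₁' : Set (Sym2 V))) (ω₂ := (↑(M₂ \ γ₂) : Set (Sym2 V))) h₁ h₂ hS
    (Finset.coe_subset.2 hω₁') (Finset.coe_subset.2 (Finset.sdiff_subset.trans hM₂)) hst
  have hexp : clusterCount (↑(ω₁ ∪ γ₂) : BondConfig V) ∅ + clusterCount (↑(ω₁' ∪ (M₂ \ γ₂)) : BondConfig V) ∅ +
      2 * Fintype.card V =
      (clusterCount (↑ω₁ : BondConfig V) ∅ + clusterCount (↑ω₁' : BondConfig V) ∅) + apExp M₂ γ₂ +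
        ((if (openGraph (↑ω₁ : BondConfig V)).Reachable s t ∧ (openGraph (↑γ₂ : BondConfig V)).Reachable s t then 1 else 0) +
          (if (openGraph (↑ω₁' : BondConfig V)).Reachable s t ∧ (openGraph (↑(M₂ \ γ₂) : BondConfig V)).Reachable s t
            then 1 else 0)) := by
    unfold apExp
    rw [Finset.coe_union, Finset.coe_union]
    omega
  have hpow : q ^ (2 * Fintype.card V) *
      q ^ (clusterCount (↑(ω₁ ∪ γ₂) : BondConfig V) ∅ + clusterCount (↑(ω₁' ∪ (M₂ \ γ₂)) : BondConfig V) ∅) =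
      q ^ (clusterCount (↑ω₁ : BondConfig V) ∅ + clusterCount (↑ω₁' : BondConfig V) ∅) * q ^ apExp M₂ γ₂ *
        (q ^ (if (openGraph (↑ω₁ : BondConfig V)).Reachable s t ∧ (openGraph (↑γ₂ : BondConfig V)).Reachable s t then 1 else 0) *
          q ^ (if (openGraph (↑ω₁' : BondConfig V)).Reachable s t ∧ (openGraph (↑(M₂ \ γ₂) : BondConfig V)).Reachable s t
            then 1 else 0)) := by
    rw [← pow_add, ← pow_add, ← pow_add, ← pow_add, add_comm (2 * Fintype.card V), hexp]
  have hc : (openGraph (↑(ω₁ ∪ γ₂) : BondConfig V)).Reachable s t ↔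
      (openGraph (↑ω₁ : BondConfig V)).Reachable s t ∨ (openGraph (↑γ₂ : BondConfig V)).Reachable s t :=
    reachable_union_parallel h₁ h₂ hS hω₁ (hγ₂.trans hM₂)
  have hcb : (openGraph (↑(ω₁' ∪ (M₂ \ γ₂)) : BondConfig V)).Reachable s t ↔
      (openGraph (↑ω₁' : BondConfig V)).Reachable s t ∨ (openGraph (↑(M₂ \ γ₂) : BondConfig V)).Reachable s t :=
    reachable_union_parallel h₁ h₂ hS hω₁' (Finset.sdiff_subset.trans hM₂)
  calc q ^ (2 * Fintype.card V) *
        (q ^ (clusterCount (↑(ω₁ ∪ γ₂) : BondConfig V) ∅ + clusterCount (↑(ω₁' ∪ (M₂ \ γ₂)) : BondConfig V) ∅) *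
          ((apConn (ω₁ ∪ γ₂) s t - apConn (ω₁' ∪ (M₂ \ γ₂)) s t) * x))
      = (q ^ (2 * Fintype.card V) *
          q ^ (clusterCount (↑(ω₁ ∪ γ₂) : BondConfig V) ∅ + clusterCount (↑(ω₁' ∪ (M₂ \ γ₂)) : BondConfig V) ∅)) *
          ((apConn (ω₁ ∪ γ₂) s t - apConn (ω₁' ∪ (M₂ \ γ₂)) s t) * x) := by ring
    _ = _ := by
      rw [hpow]
      unfold apConn
      rw [hc, hcb]
      by_cases a₁ : (openGraph (↑ω₁ : BondConfig V)).Reachable s t <;>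
      by_cases a₂ : (openGraph (↑γ₂ : BondConfig V)).Reachable s t <;>
      by_cases b₁ : (openGraph (↑ω₁' : BondConfig V)).Reachable s t <;>
      by_cases b₂ : (openGraph (↑(M₂ \ γ₂) : BondConfig V)).Reachable s t <;>
      simp only [a₁, a₂, b₁, b₂, and_self, and_true, true_and, and_false, false_and, or_self, or_true, true_or, or_false,
        false_or, if_true, if_false, not_false_eq_true, not_true_eq_false, pow_one, pow_zero] <;> ring

set_option linter.unusedSimpArgs false in
/-- **Series gluing, general pair on the first side** (`(a, m)`-part first, `(m, b)`-part second):
`q^{2|V|} q^{k(ω₁∪γ₂)+k(ω₁'∪γ₂ᶜ)}(c c₂ - c' c̄₂) = q^{a₂} c̄₂·q^{k(ω₁)+k(ω₁')}(c - c') + q^{k(ω₁)+k(ω₁')} c·q^{a₂}(c₂ - c̄₂)`. [cite: Grimmett2006, §3.8 (pp. 61–62)] -/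
theorem ap_summand_series_gen (q : ℝ) {a m b : V} (h₁ : ∀ e ∈ (↑E₁ : Set (Sym2 V)), ∀ z ∈ e, z ∈ V₁)
    (h₂ : ∀ e ∈ (↑E₂ : Set (Sym2 V)), ∀ z ∈ e, z ∈ V₂) (hS : V₁ ∩ V₂ ⊆ {m}) (haV₂ : a ∉ V₂) (hbV₁ : b ∉ V₁)
    (ham : a ≠ m) (hbm : b ≠ m) (hab : a ≠ b)
    {ω₁ ω₁' M₂ γ₂ : Finset (Sym2 V)} (hω₁ : ω₁ ⊆ E₁) (hω₁' : ω₁' ⊆ E₁) (hM₂ : M₂ ⊆ E₂) (hγ₂ : γ₂ ⊆ M₂) (x : ℝ) :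
    q ^ (2 * Fintype.card V) *
        (q ^ (clusterCount (↑(ω₁ ∪ γ₂) : BondConfig V) ∅ + clusterCount (↑(ω₁' ∪ (M₂ \ γ₂)) : BondConfig V) ∅) *
          ((apConn (ω₁ ∪ γ₂) a b - apConn (ω₁' ∪ (M₂ \ γ₂)) a b) * x)) =
      q ^ apExp M₂ γ₂ * (apConn (M₂ \ γ₂) m b *
          (q ^ (clusterCount (↑ω₁ : BondConfig V) ∅ + clusterCount (↑ω₁' : BondConfig V) ∅) *
            ((apConn ω₁ a m - apConn ω₁' a m) * x))) +
        q ^ (clusterCount (↑ω₁ : BondConfig V) ∅ + clusterCount (↑ω₁' : BondConfig V) ∅) * (apConn ω₁ a m *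
          (q ^ apExp M₂ γ₂ * ((apConn γ₂ m b - apConn (M₂ \ γ₂) m b) * x))) := by
  have k1 := clusterCount_series (ω₁ := (↑ω₁ : Set (Sym2 V))) (ω₂ := (↑γ₂ : Set (Sym2 V))) h₁ h₂ hS
    (Finset.coe_subset.2 hω₁) (Finset.coe_subset.2 (hγ₂.trans hM₂))
  have k2 := clusterCount_series (ω₁ := (↑ω₁' : Set (Sym2 V))) (ω₂ := (↑(M₂ \ γ₂) : Set (Sym2 V))) h₁ h₂ hS
    (Finset.coe_subset.2 hω₁') (Finset.coe_subset.2 (Finset.sdiff_subset.trans hM₂))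
  have hexp : clusterCount (↑(ω₁ ∪ γ₂) : BondConfig V) ∅ + clusterCount (↑(ω₁' ∪ (M₂ \ γ₂)) : BondConfig V) ∅ +
      2 * Fintype.card V = (clusterCount (↑ω₁ : BondConfig V) ∅ + clusterCount (↑ω₁' : BondConfig V) ∅) + apExp M₂ γ₂ := by
    unfold apExp
    rw [Finset.coe_union, Finset.coe_union]
    omega
  have hpow : q ^ (2 * Fintype.card V) *
      q ^ (clusterCount (↑(ω₁ ∪ γ₂) : BondConfig V) ∅ + clusterCount (↑(ω₁' ∪ (M₂ \ γ₂)) : BondConfig V) ∅) =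
      q ^ (clusterCount (↑ω₁ : BondConfig V) ∅ + clusterCount (↑ω₁' : BondConfig V) ∅) * q ^ apExp M₂ γ₂ := by
    rw [← pow_add, ← pow_add, add_comm (2 * Fintype.card V), hexp]
  have hc : (openGraph (↑(ω₁ ∪ γ₂) : BondConfig V)).Reachable a b ↔
      (openGraph (↑ω₁ : BondConfig V)).Reachable a m ∧ (openGraph (↑γ₂ : BondConfig V)).Reachable m b :=
    reachable_union_series h₁ h₂ hS haV₂ hbV₁ ham hbm hab hω₁ (hγ₂.trans hM₂)
  have hcb : (openGraph (↑(ω₁' ∪ (M₂ \ γ₂)) : BondConfig V)).Reachable a b ↔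
      (openGraph (↑ω₁' : BondConfig V)).Reachable a m ∧ (openGraph (↑(M₂ \ γ₂) : BondConfig V)).Reachable m b :=
    reachable_union_series h₁ h₂ hS haV₂ hbV₁ ham hbm hab hω₁' (Finset.sdiff_subset.trans hM₂)
  calc q ^ (2 * Fintype.card V) *
        (q ^ (clusterCount (↑(ω₁ ∪ γ₂) : BondConfig V) ∅ + clusterCount (↑(ω₁' ∪ (M₂ \ γ₂)) : BondConfig V) ∅) *
          ((apConn (ω₁ ∪ γ₂) a b - apConn (ω₁' ∪ (M₂ \ γ₂)) a b) * x))
      = (q ^ (2 * Fintype.card V) *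
          q ^ (clusterCount (↑(ω₁ ∪ γ₂) : BondConfig V) ∅ + clusterCount (↑(ω₁' ∪ (M₂ \ γ₂)) : BondConfig V) ∅)) *
          ((apConn (ω₁ ∪ γ₂) a b - apConn (ω₁' ∪ (M₂ \ γ₂)) a b) * x) := by ring
    _ = _ := by
      rw [hpow]
      unfold apConn
      rw [hc, hcb]
      by_cases a₁ : (openGraph (↑ω₁ : BondConfig V)).Reachable a m <;>
      by_cases a₂ : (openGraph (↑γ₂ : BondConfig V)).Reachable m b <;>
      by_cases b₁ : (openGraph (↑ω₁' : BondConfig V)).Reachable a m <;>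
      by_cases b₂ : (openGraph (↑(M₂ \ γ₂) : BondConfig V)).Reachable m b <;>
      simp only [a₁, a₂, b₁, b₂, and_self, and_true, true_and, and_false, false_and, if_true, if_false,
        not_false_eq_true, not_true_eq_false] <;> ring

set_option linter.unusedSimpArgs false in
/-- **Series gluing, general pair on the SECOND side** (`(a, m)`-part unmarked first, `(m, b)`-part carrying the general pair):
`q^{2|V|} q^{k(γ₁∪ω₂)+k(γ₁ᶜ∪ω₂')}(c₁ c - c̄₁ c') = q^{k(ω₂)+k(ω₂')} c'·q^{a₁}(c₁ - c̄₁) + q^{a₁} c₁·q^{k(ω₂)+k(ω₂')}(c - c')`. [cite: Grimmett2006, §3.8 (pp. 61–62)] -/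
theorem ap_summand_series_gen' (q : ℝ) {a m b : V} (h₁ : ∀ e ∈ (↑E₁ : Set (Sym2 V)), ∀ z ∈ e, z ∈ V₁)
    (h₂ : ∀ e ∈ (↑E₂ : Set (Sym2 V)), ∀ z ∈ e, z ∈ V₂) (hS : V₁ ∩ V₂ ⊆ {m}) (haV₂ : a ∉ V₂) (hbV₁ : b ∉ V₁)
    (ham : a ≠ m) (hbm : b ≠ m) (hab : a ≠ b)
    {M₁ γ₁ ω₂ ω₂' : Finset (Sym2 V)} (hM₁ : M₁ ⊆ E₁) (hγ₁ : γ₁ ⊆ M₁) (hω₂ : ω₂ ⊆ E₂) (hω₂' : ω₂' ⊆ E₂) (x : ℝ) :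
    q ^ (2 * Fintype.card V) *
        (q ^ (clusterCount (↑(γ₁ ∪ ω₂) : BondConfig V) ∅ + clusterCount (↑((M₁ \ γ₁) ∪ ω₂') : BondConfig V) ∅) *
          ((apConn (γ₁ ∪ ω₂) a b - apConn ((M₁ \ γ₁) ∪ ω₂') a b) * x)) =
      q ^ (clusterCount (↑ω₂ : BondConfig V) ∅ + clusterCount (↑ω₂' : BondConfig V) ∅) * (apConn ω₂' m b *
          (q ^ apExp M₁ γ₁ * ((apConn γ₁ a m - apConn (M₁ \ γ₁) a m) * x))) +
        q ^ apExp M₁ γ₁ * (apConn γ₁ a m *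
          (q ^ (clusterCount (↑ω₂ : BondConfig V) ∅ + clusterCount (↑ω₂' : BondConfig V) ∅) *
            ((apConn ω₂ m b - apConn ω₂' m b) * x))) := by
  have k1 := clusterCount_series (ω₁ := (↑γ₁ : Set (Sym2 V))) (ω₂ := (↑ω₂ : Set (Sym2 V))) h₁ h₂ hS
    (Finset.coe_subset.2 (hγ₁.trans hM₁)) (Finset.coe_subset.2 hω₂)
  have k2 := clusterCount_series (ω₁ := (↑(M₁ \ γ₁) : Set (Sym2 V))) (ω₂ := (↑ω₂' : Set (Sym2 V))) h₁ h₂ hS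
    (Finset.coe_subset.2 (Finset.sdiff_subset.trans hM₁)) (Finset.coe_subset.2 hω₂')
  have hexp : clusterCount (↑(γ₁ ∪ ω₂) : BondConfig V) ∅ + clusterCount (↑((M₁ \ γ₁) ∪ ω₂') : BondConfig V) ∅ +
      2 * Fintype.card V = apExp M₁ γ₁ + (clusterCount (↑ω₂ : BondConfig V) ∅ + clusterCount (↑ω₂' : BondConfig V) ∅) := by
    unfold apExp
    rw [Finset.coe_union, Finset.coe_union]
    omega
  have hpow : q ^ (2 * Fintype.card V) *
      q ^ (clusterCount (↑(γ₁ ∪ ω₂) : BondConfig V) ∅ + clusterCount (↑((M₁ \ γ₁) ∪ ω₂') : BondConfig V) ∅) =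
      q ^ apExp M₁ γ₁ * q ^ (clusterCount (↑ω₂ : BondConfig V) ∅ + clusterCount (↑ω₂' : BondConfig V) ∅) := by
    rw [← pow_add, ← pow_add, add_comm (2 * Fintype.card V), hexp]
  have hc : (openGraph (↑(γ₁ ∪ ω₂) : BondConfig V)).Reachable a b ↔
      (openGraph (↑γ₁ : BondConfig V)).Reachable a m ∧ (openGraph (↑ω₂ : BondConfig V)).Reachable m b :=
    reachable_union_series h₁ h₂ hS haV₂ hbV₁ ham hbm hab (hγ₁.trans hM₁) hω₂
  have hcb : (openGraph (↑((M₁ \ γ₁) ∪ ω₂') : BondConfig V)).Reachable a b ↔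
      (openGraph (↑(M₁ \ γ₁) : BondConfig V)).Reachable a m ∧ (openGraph (↑ω₂' : BondConfig V)).Reachable m b :=
    reachable_union_series h₁ h₂ hS haV₂ hbV₁ ham hbm hab (Finset.sdiff_subset.trans hM₁) hω₂'
  calc q ^ (2 * Fintype.card V) *
        (q ^ (clusterCount (↑(γ₁ ∪ ω₂) : BondConfig V) ∅ + clusterCount (↑((M₁ \ γ₁) ∪ ω₂') : BondConfig V) ∅) *
          ((apConn (γ₁ ∪ ω₂) a b - apConn ((M₁ \ γ₁) ∪ ω₂') a b) * x))
      = (q ^ (2 * Fintype.card V) *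
          q ^ (clusterCount (↑(γ₁ ∪ ω₂) : BondConfig V) ∅ + clusterCount (↑((M₁ \ γ₁) ∪ ω₂') : BondConfig V) ∅)) *
          ((apConn (γ₁ ∪ ω₂) a b - apConn ((M₁ \ γ₁) ∪ ω₂') a b) * x) := by ring
    _ = _ := by
      rw [hpow]
      unfold apConn
      rw [hc, hcb]
      by_cases a₁ : (openGraph (↑γ₁ : BondConfig V)).Reachable a m <;>
      by_cases a₂ : (openGraph (↑ω₂ : BondConfig V)).Reachable m b <;>
      by_cases b₁ : (openGraph (↑(M₁ \ γ₁) : BondConfig V)).Reachable a m <;>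
      by_cases b₂ : (openGraph (↑ω₂' : BondConfig V)).Reachable m b <;>
      simp only [a₁, a₂, b₁, b₂, and_self, and_true, true_and, and_false, false_and, if_true, if_false,
        not_false_eq_true, not_true_eq_false] <;> ring

end Pointwise


end FK

end Summit.CriticalPhenomena.PercolationContinuityZ3.Theorems

end
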